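import Summits.AtomisticToContinuum.FouriersLaw.Theses.BondHeatUncertainty

/-!
# `ExtensiveSnapshotIrreversibility` — load-bearing hypotheses (negative lemmas, cdisprove)

Support file for crux item `stmt-AtomisticToContinuum-9121` (route `BondHeatUncertainty`, decl
`ExtensiveSnapshotIrreversibility`).  Two hypotheses of the crux cannot be dropped:

* the steady-state-family hypothesis (`extensiveSnapshotIrreversibility_false_without_family`):
  along the Dirac family `μ N T_L T_R = δ_{(0,1)}` the snapshot divergence
  `KL(μ ‖ Θ_*μ)` is `+∞` at `N = 1` (a point mass off the fixed-point set of the momentum flip is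
  singular to its flip), so no bound `C·N·δ²` holds eventually;
* positivity of the mean temperature, even in the weakened form `0 ≤ T`
  (`extensiveSnapshotIrreversibility_false_with_T_nonneg`): at `T = 0` one of the bath
  temperatures `T ± δ/2` is `≤ 0` for EVERY `δ ≠ 0`, where "steady-state family" asks nothing,
  so a genuine steady-state family (CEHR 2018 existence, `pinnedChain_exists_isSteadyState`)
  patched by the bad point mass at non-positive temperatures violates the bound.

Both are stated with the uniqueness guard of the crux dropped (with the guard kept they hold
conditionally on `NessUnique`, see the crux work file `Cruxes/…/Disproof.lean`): any proof of the
crux must use that `μ` is a steady-state family AT the temperatures `T ± δ/2`, i.e. must use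
`0 < T`.
-/

namespace Summit.AtomisticToContinuum.FouriersLaw.Theorems.ExtensiveSnapshotIrreversibility.Negative

open MeasureTheory Filter Topology InformationTheory
open scoped ENNReal
open Literature.MathematicalPhysics.KineticTheory.HeatConduction

/-- A point mass off the fixed-point set of the momentum flip is singular to its flip:
`KL(δ_z ‖ Θ_* δ_z) = ∞`. [folklore] -/
theorem klDiv_dirac_flip_eq_top {N : ℕ} {z : PhaseSpace N} (hz : (z.1, -z.2) ≠ z) :
    klDiv (Measure.dirac z) (Measure.map (fun x : PhaseSpace N => (x.1, -x.2)) (Measure.dirac z))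
      = ∞ := by
  have hm : Measurable (fun x : PhaseSpace N => (x.1, -x.2)) := (momentumReversal N).measurable
  rw [Measure.map_dirac' hm]
  refine klDiv_of_not_ac fun h => ?_
  have h0 : Measure.dirac (z.1, -z.2) {z} = 0 := by
    rw [Measure.dirac_apply' _ (measurableSet_singleton z)]
    simp [Set.indicator, hz]
  have h1 := h h0
  simp at h1

/-- The bad point `(q, p) = (0, 1)` is moved by the flip when `N ≥ 1`. [folklore] -/
theorem flip_ne_of_pos {N : ℕ} (hN : 0 < N) :
    ((((fun _ => 0, fun _ => 1) : PhaseSpace N)).1, -(((fun _ => 0, fun _ => 1) : PhaseSpace N)).2)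
      ≠ ((fun _ => 0, fun _ => 1) : PhaseSpace N) := by
  intro h
  have h2 := congrArg (fun z : PhaseSpace N => z.2 ⟨0, hN⟩) h
  simp only [Pi.neg_apply] at h2
  norm_num at h2

/-- No eventual finite bound on the snapshot divergence of the bad point mass at `N = 1`.
[folklore] -/
theorem not_eventually_klDiv_dirac_le (g : ℝ → ℝ≥0∞) (hg : ∀ δ, g δ ≠ ∞) :
    ¬ ∀ᶠ δ in 𝓝[≠] (0 : ℝ),
      klDiv (Measure.dirac ((fun _ => 0, fun _ => 1) : PhaseSpace 1))
        (Measure.map (fun x : PhaseSpace 1 => (x.1, -x.2))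
          (Measure.dirac ((fun _ => 0, fun _ => 1) : PhaseSpace 1))) ≤ g δ := by
  intro h
  obtain ⟨δ, hδ⟩ := h.exists
  rw [klDiv_dirac_flip_eq_top (flip_ne_of_pos Nat.one_pos), top_le_iff] at hδ
  exact hg δ hδ

/-- **The steady-state-family hypothesis of `ExtensiveSnapshotIrreversibility` is load-bearing**:
with it (and the uniqueness guard) removed, the statement is false — witness the Dirac family
`μ N T_L T_R = δ_{(0,1)}` at `N = 1`. [folklore] -/
theorem extensiveSnapshotIrreversibility_false_without_family :
    ¬ (∀ ω₂ lam β γ : ℝ, 0 < ω₂ → 0 < lam → 0 < β → 0 < γ →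
        ∀ μ : (N : ℕ) → ℝ → ℝ → Measure (PhaseSpace N), ∀ T : ℝ, 0 < T →
          ∃ C : ℝ, ∀ N : ℕ, ∀ᶠ δ in 𝓝[≠] (0 : ℝ),
            klDiv (μ N (T + δ / 2) (T - δ / 2))
              (Measure.map (fun x : PhaseSpace N => (x.1, -x.2)) (μ N (T + δ / 2) (T - δ / 2)))
                ≤ ENNReal.ofReal (C * (N : ℝ) * δ ^ 2)) := by
  intro h
  obtain ⟨C, hC⟩ := h 1 1 1 1 one_pos one_pos one_pos one_pos
    (fun N _ _ => Measure.dirac ((fun _ => 0, fun _ => 1) : PhaseSpace N)) 1 one_pos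
  exact not_eventually_klDiv_dirac_le _ (fun δ => ENNReal.ofReal_ne_top) (hC 1)

/-- **`0 < T` is load-bearing in `ExtensiveSnapshotIrreversibility`, even against `0 ≤ T`**
(uniqueness guard removed): a genuine steady-state family at positive temperatures
(`pinnedChain_exists_isSteadyState`, CEHR 2018) patched by the bad point mass where a bath
temperature is non-positive is still a steady-state family, and at mean temperature `T = 0` it
is the point mass for every `δ`. [folklore] -/
theorem extensiveSnapshotIrreversibility_false_with_T_nonneg :
    ¬ (∀ ω₂ lam β γ : ℝ, 0 < ω₂ → 0 < lam → 0 < β → 0 < γ →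
        ∀ μ : (N : ℕ) → ℝ → ℝ → Measure (PhaseSpace N),
          (∀ (N : ℕ) (T_L T_R : ℝ), 0 < T_L → 0 < T_R →
            (pinnedChain ω₂ lam β γ).IsSteadyState N T_L T_R (μ N T_L T_R)) →
          ∀ T : ℝ, 0 ≤ T →
            ∃ C : ℝ, ∀ N : ℕ, ∀ᶠ δ in 𝓝[≠] (0 : ℝ),
              klDiv (μ N (T + δ / 2) (T - δ / 2))
                (Measure.map (fun x : PhaseSpace N => (x.1, -x.2)) (μ N (T + δ / 2) (T - δ / 2)))
                  ≤ ENNReal.ofReal (C * (N : ℝ) * δ ^ 2)) := by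
  intro h
  classical
  let μ : (N : ℕ) → ℝ → ℝ → Measure (PhaseSpace N) := fun N T_L T_R =>
    if hp : 0 < T_L ∧ 0 < T_R then
      Classical.choose (pinnedChain_exists_isSteadyState one_pos one_pos one_pos one_pos N hp.1 hp.2)
    else Measure.dirac ((fun _ => 0, fun _ => 1) : PhaseSpace N)
  have hμ : ∀ (N : ℕ) (T_L T_R : ℝ), 0 < T_L → 0 < T_R →
      (pinnedChain 1 1 1 1).IsSteadyState N T_L T_R (μ N T_L T_R) := by
    intro N T_L T_R hL hR
    simp only [μ, dif_pos (And.intro hL hR)]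
    exact Classical.choose_spec
      (pinnedChain_exists_isSteadyState one_pos one_pos one_pos one_pos N hL hR)
  obtain ⟨C, hC⟩ := h 1 1 1 1 one_pos one_pos one_pos one_pos μ hμ 0 le_rfl
  have h1 := hC 1
  have hbad : ∀ δ : ℝ, μ 1 (0 + δ / 2) (0 - δ / 2) =
      Measure.dirac ((fun _ => 0, fun _ => 1) : PhaseSpace 1) := fun δ => by
    have hn : ¬ (0 < 0 + δ / 2 ∧ 0 < 0 - δ / 2) := fun h => by linarith [h.1, h.2]
    simp only [μ, dif_neg hn]
  simp only [hbad] at h1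
  exact not_eventually_klDiv_dirac_le _ (fun δ => ENNReal.ofReal_ne_top) h1

end Summit.AtomisticToContinuum.FouriersLaw.Theorems.ExtensiveSnapshotIrreversibility.Negative
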